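import Summits.QuantumAdvantage.QuantumAdvantage.Theorems.CubicForrelationNearExactIsExactTwelveOddWeightR4Dual
import Summits.QuantumAdvantage.QuantumAdvantage.Theorems.CubicForrelationNearExactIsExactTwelveOddWeightR4ArithB
import Summits.QuantumAdvantage.QuantumAdvantage.Theorems.CubicForrelationNearExactIsExactTypeE8

/-!
# Crux `CubicForrelation.NearExactIsExact` (stmt-QuantumAdvantage-14043) — n = 12, WEIGHT OF A TYPE-O CUBIC, VII: case R4 — a derivative with
  exactly `1536` ones forces weight `≥ 1304`

Certificate seat `b2b-cforr-cert` (gen 32).  HONEST FRAMING: a kernel-checked finite-slice theorem (standard axioms) — the second of the two cases of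
"a cubic Boolean function on 12 bits with weight `≡ 8 (mod 16)` has weight `≥ 1280`" (…TwelveOddWeight*, killing the "`κ₁` type O" branch of the
wild (O,O) analysis of the open window `(57/64, 29/32)`).  NOT summit progress; no value of `θ₁₂`.

`tow_weight_R4`: `κ` cubic on 12 bits, `wt κ ≡ 8 (mod 16)`, `a ≠ 0` with `#{x : κ x ≠ κ(x⊕a)} = 1536`.  Then `wt κ ≥ 1304`.
Proof.  The derivative `q = D_aκ` is the product pair of its four affine derivatives `φ₀ = D_{a₁}q, φ₁ = D_{a₀}q, φ₂ = D_{a₃}q, φ₃ = D_{a₂}q`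
along a symplectic frame (`tow_R4_frame`): `q = φ₀φ₁ ⊕ φ₂φ₃`.  With a fifth form `y₅` (`⟨a,y₅⟩` odd, orthogonalised against the frame) the
`32` cells `{φ = k, ⟨·,y₅⟩ = c}` are 7-flats of `128` points; `x ↦ x ⊕ a` swaps the two sides and `κ(x⊕a) = κ(x) ⊕ π(k)`,
`π(k) = k₀k₁ ⊕ k₂k₃`, so `wt κ = 768 + 2·Σ_{π(k)=0} s_k` with `s_k` the side-`0` counts; unions of four cells cut out by two mask conditions are
9-flats, all translates of one annihilator, so the TYPE PRINCIPLE (`tow_flat_type`) makes their residues `mod 8` independent of the translate and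
Kasami–Tokura (`tow_flat9_kt`) bounds the odd ones below by `132`; the arithmetic core `tow_r4_arith` then gives `Σ_{π=0} s ≥ 268`.

References: L. E. Dickson (1901); T. Kasami, N. Tokura (1970); F. J. MacWilliams, N. J. A. Sloane (1977) Ch. 15.  Axioms: the standard three.
-/

set_option linter.dupNamespace false -- D-0017: single-problem summit ⇒ `QuantumAdvantage.QuantumAdvantage` by design

noncomputable section

namespace Summit.QuantumAdvantage.QuantumAdvantage.Theorems.CubicForrelation.NearExactIsExact

open Finset
open Literature.Computability.QuantumComplexity
open Literature.Computability.QuantumComplexity.BuzetChailloux (bxor zeroVec bxor_bxor_cancel_left bxor_zeroVec zeroVec_bxor bxor_comm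
  bxor_self twist_bxor_right twist_zeroVec_right sum_twist_left bxor_eq_zeroVec_iff)
open Literature.Computability.QuantumComplexity.DerivativeWalsh (W twist_bxor_left)
open Summit.QuantumAdvantage.QuantumAdvantage.Theorems.CubicForrelation.ExactPairsMaioranaMcFarland (dv_bxor_cancel_right)

/-- `m·k` over `𝔽₂` for two 4-bit numbers (local notation, not a definition). -/
local notation3 (prettyPrint := false) "𝕚" m:max k:max =>
  ((Nat.testBit m 0 && Nat.testBit k 0) ^^ (Nat.testBit m 1 && Nat.testBit k 1) ^^
    (Nat.testBit m 2 && Nat.testBit k 2) ^^ (Nat.testBit m 3 && Nat.testBit k 3))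

/-- `π(k) = k₀k₁ ⊕ k₂k₃` (local notation). -/
local notation3 (prettyPrint := false) "πq" k:max =>
  ((Nat.testBit k 0 && Nat.testBit k 1) ^^ (Nat.testBit k 2 && Nat.testBit k 3))

/-- The side-`0` count of the union of cells `{k : m₁·k = c₁, m₂·k = c₂}` (local notation). -/
local notation3 (prettyPrint := false) "CS" s:max m₁:max m₂:max c₁:max c₂:max =>
  (∑ k ∈ Finset.range 16, if (𝕚 m₁ k = c₁ ∧ 𝕚 m₂ k = c₂) then s k else 0)

/-- The side-`1` count of the same union (local notation). -/
local notation3 (prettyPrint := false) "CT" s:max m₁:max m₂:max c₁:max c₂:max =>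
  (∑ k ∈ Finset.range 16, if (𝕚 m₁ k = c₁ ∧ 𝕚 m₂ k = c₂) then (if πq k = true then 128 - s k else s k) else 0)

/-- The side-`0` count of the ten cells with `π(k) = 0` (local notation). -/
local notation3 (prettyPrint := false) "ZS" s:max => (∑ k ∈ Finset.range 16, if πq k = false then s k else 0)

/-- `∀ i : Fin 3` as a conjunction. [folklore] -/
private theorem tow_forall_fin3P (P : Fin 3 → Prop) : (∀ i, P i) ↔ P 0 ∧ P 1 ∧ P 2 := by
  constructor
  · intro h; exact ⟨h 0, h 1, h 2⟩
  · rintro ⟨h0, h1, h2⟩ i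
    fin_cases i
    · exact h0
    · exact h1
    · exact h2

/-- `∀ i : Fin 5` as a conjunction. [folklore] -/
private theorem tow_forall_fin5 (P : Fin 5 → Prop) : (∀ i, P i) ↔ P 0 ∧ P 1 ∧ P 2 ∧ P 3 ∧ P 4 := by
  constructor
  · intro h; exact ⟨h 0, h 1, h 2, h 3, h 4⟩
  · rintro ⟨h0, h1, h2, h3, h4⟩ i
    fin_cases i
    · exact h0
    · exact h1
    · exact h2
    · exact h3
    · exact h4

set_option maxHeartbeats 800000 in
/-- **Case R4.**  A cubic `κ` on 12 bits with `wt κ ≡ 8 (mod 16)` and a direction `a ≠ 0` along which exactly `1536` points change value has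
`wt κ ≥ 1304`.  Finite-slice statement, NOT summit progress. [this work] -/
theorem tow_weight_R4 (κ : (Fin (6 + 6) → Bool) → Bool) (hκ : IsDegLeFun 3 κ)
    (hw : #(univ.filter fun x : Fin (6 + 6) → Bool => κ x = true) % 16 = 8)
    (a : Fin (6 + 6) → Bool) (ha : a ≠ zeroVec) (hDa : #(univ.filter fun x => (κ x ^^ κ (bxor x a)) = true) = 1536) :
    1304 ≤ #(univ.filter fun x : Fin (6 + 6) → Bool => κ x = true) := by
  classical
  obtain ⟨u, hu, hodd⟩ := tow_typeO_of_weight κ hκ hw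
  set q : (Fin (6 + 6) → Bool) → Bool := fun x => κ x ^^ κ (bxor x a) with hqdef
  have hq2 : IsDegLeFun 2 q := stub_derivDegree (6 + 6) 2 κ a hκ
  have hqa : ∀ x, q (bxor x a) = q x := fun x => by
    show (κ (bxor x a) ^^ κ (bxor (bxor x a) a)) = (κ x ^^ κ (bxor x a))
    rw [dv_bxor_cancel_right, Bool.xor_comm]
  obtain ⟨a₀, a₁, a₂, a₃, h01, h23, h02, h03, h12, h13, hform⟩ := tow_R4_frame q hq2 hDa
  obtain ⟨c₀, c₁, c₂, c₃, y₅, b₀, b₁, b₂, b₃, hc₀, hc₁, hc₂, hc₃, hay₅, hdual⟩ :=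
    tow_R4_forms q hq2 a ha hqa a₀ a₁ a₂ a₃ h01 h23 h02 h03 h12 h13
  set zz : Fin 5 → Fin (6 + 6) → Bool := ![c₀, c₁, c₂, c₃, y₅] with hzz
  have hind := tow_indep_of_dual zz ![a₀, a₁, a₂, a₃, a] hdual
  -- labels
  set lab : (Fin (6 + 6) → Bool) → ℕ := fun x =>
    (if (q x ^^ q (bxor x a₁)) then 1 else 0) + (if (q x ^^ q (bxor x a₀)) then 2 else 0) + (if (q x ^^ q (bxor x a₃)) then 4 else 0) +
      (if (q x ^^ q (bxor x a₂)) then 8 else 0) with hlab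
  have hlabbits : ∀ x, lab x < 16 ∧ Nat.testBit (lab x) 0 = (q x ^^ q (bxor x a₁)) ∧ Nat.testBit (lab x) 1 = (q x ^^ q (bxor x a₀)) ∧
      Nat.testBit (lab x) 2 = (q x ^^ q (bxor x a₃)) ∧ Nat.testBit (lab x) 3 = (q x ^^ q (bxor x a₂)) := fun x => tow_label_bits _ _ _ _
  -- `π(label) = q`
  have hπ : ∀ x, (πq (lab x)) = q x := by
    intro x
    obtain ⟨-, e0, e1, e2, e3⟩ := hlabbits x
    rw [e0, e1, e2, e3, ← hform x]
  -- the label does not change under `⊕ a`, the side flips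
  have hlaba : ∀ x, lab (bxor x a) = lab x := by
    intro x
    have e : ∀ a', (q (bxor x a) ^^ q (bxor (bxor x a) a')) = (q x ^^ q (bxor x a')) := fun a' => by
      rw [hqa, show bxor (bxor x a) a' = bxor (bxor x a') a by
        funext j; show ((x j ^^ a j) ^^ a' j) = ((x j ^^ a' j) ^^ a j); cases x j <;> cases a j <;> cases a' j <;> rfl, hqa]
    simp only [hlab, e]
  have hsidea : ∀ x, decide (Odd #(univ.filter fun j => bxor x a j && y₅ j)) = !decide (Odd #(univ.filter fun j => x j && y₅ j)) := by
    intro x; rw [tow_parity_bxor, hay₅]; cases decide (Odd #(univ.filter fun j => x j && y₅ j)) <;> rfl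
  -- cells
  set Cell : ℕ → Bool → Finset (Fin (6 + 6) → Bool) := fun k c =>
    univ.filter fun x => lab x = k ∧ decide (Odd #(univ.filter fun j => x j && y₅ j)) = c with hCell
  have hCellpar : ∀ k < 16, ∀ c, Cell k c = univ.filter fun x : Fin (6 + 6) → Bool => ∀ i, decide (Odd #(univ.filter fun j => x j && zz i j)) =
      (![xor (Nat.testBit k 0) b₀, xor (Nat.testBit k 1) b₁, xor (Nat.testBit k 2) b₂, xor (Nat.testBit k 3) b₃, c] : Fin 5 → Bool) i := by
    intro k hk c
    refine filter_congr fun x _ => ?_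
    rw [tow_forall_fin5]
    simp only [Matrix.cons_val_zero, Matrix.cons_val_one]
    have ez2 : zz 2 = c₂ := rfl
    have ez3 : zz 3 = c₃ := rfl
    have ez4 : zz 4 = y₅ := rfl
    have ev2 : (![xor (Nat.testBit k 0) b₀, xor (Nat.testBit k 1) b₁, xor (Nat.testBit k 2) b₂, xor (Nat.testBit k 3) b₃, c] : Fin 5 → Bool) 2 =
      xor (Nat.testBit k 2) b₂ := rfl
    have ev3 : (![xor (Nat.testBit k 0) b₀, xor (Nat.testBit k 1) b₁, xor (Nat.testBit k 2) b₂, xor (Nat.testBit k 3) b₃, c] : Fin 5 → Bool) 3 =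
      xor (Nat.testBit k 3) b₃ := rfl
    have ev4 : (![xor (Nat.testBit k 0) b₀, xor (Nat.testBit k 1) b₁, xor (Nat.testBit k 2) b₂, xor (Nat.testBit k 3) b₃, c] : Fin 5 → Bool) 4 = c := rfl
    rw [ez2, ez3, ez4, ev2, ev3, ev4]
    show (lab x = k ∧ _) ↔ (decide (Odd #(univ.filter fun j => x j && c₀ j)) = _ ∧ decide (Odd #(univ.filter fun j => x j && c₁ j)) = _ ∧
      decide (Odd #(univ.filter fun j => x j && c₂ j)) = _ ∧ decide (Odd #(univ.filter fun j => x j && c₃ j)) = _ ∧ _)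
    obtain ⟨hlt, e0, e1, e2, e3⟩ := hlabbits x
    have f0 : decide (Odd #(univ.filter fun j => x j && c₀ j)) = ((q x ^^ q (bxor x a₁)) ^^ b₀) := by
      rw [hc₀ x]; cases b₀ <;> simp
    have f1 : decide (Odd #(univ.filter fun j => x j && c₁ j)) = ((q x ^^ q (bxor x a₀)) ^^ b₁) := by
      rw [hc₁ x]; cases b₁ <;> simp
    have f2 : decide (Odd #(univ.filter fun j => x j && c₂ j)) = ((q x ^^ q (bxor x a₃)) ^^ b₂) := by
      rw [hc₂ x]; cases b₂ <;> simp
    have f3 : decide (Odd #(univ.filter fun j => x j && c₃ j)) = ((q x ^^ q (bxor x a₂)) ^^ b₃) := by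
      rw [hc₃ x]; cases b₃ <;> simp
    rw [f0, f1, f2, f3, ← e0, ← e1, ← e2, ← e3]
    constructor
    · rintro ⟨rfl, hc'⟩; exact ⟨rfl, rfl, rfl, rfl, hc'⟩
    · rintro ⟨g0, g1, g2, g3, hc'⟩
      refine ⟨tow_eq_of_bits hlt hk ?_ ?_ ?_ ?_, hc'⟩
      · revert g0; cases Nat.testBit (lab x) 0 <;> cases Nat.testBit k 0 <;> cases b₀ <;> simp
      · revert g1; cases Nat.testBit (lab x) 1 <;> cases Nat.testBit k 1 <;> cases b₁ <;> simp
      · revert g2; cases Nat.testBit (lab x) 2 <;> cases Nat.testBit k 2 <;> cases b₂ <;> simp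
      · revert g3; cases Nat.testBit (lab x) 3 <;> cases Nat.testBit k 3 <;> cases b₃ <;> simp
  have hCellcard : ∀ k < 16, ∀ c, #(Cell k c) = 128 := by
    intro k hk c
    have h := tow_card_paritySet zz (![xor (Nat.testBit k 0) b₀, xor (Nat.testBit k 1) b₁, xor (Nat.testBit k 2) b₂, xor (Nat.testBit k 3) b₃, c])
      hind
    rw [← hCellpar k hk c] at h
    have e : (2 : ℕ) ^ (6 + 6) = 4096 := by norm_num
    have e5 : (2 : ℕ) ^ 5 = 32 := by norm_num
    rw [e, e5] at h
    omega
  -- side-0 counts and the pairing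
  set s : ℕ → ℕ := fun k => #((Cell k false).filter fun x => κ x = true) with hsdef
  have hmove : ∀ k x, x ∈ Cell k false ↔ bxor x a ∈ Cell k true := by
    intro k x
    simp only [hCell, mem_filter, mem_univ, true_and, hlaba, hsidea]
    cases decide (Odd #(univ.filter fun j => x j && y₅ j)) <;> simp
  have hκa : ∀ x, κ (bxor x a) = (κ x ^^ q x) := fun x => by
    show κ (bxor x a) = (κ x ^^ (κ x ^^ κ (bxor x a))); cases κ x <;> cases κ (bxor x a) <;> rfl
  have hside1 : ∀ k < 16, #((Cell k true).filter fun x => κ x = true) = if (πq k) = true then 128 - s k else s k := by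
    intro k hk
    rw [tow_card_filter_translate (Cell k false) (Cell k true) a κ (hmove k)]
    have hq_on : ∀ x ∈ Cell k false, q x = (πq k) := by
      intro x hx
      rw [← hπ x, (mem_filter.1 hx).2.1]
    split_ifs with hpk
    · have e : ((Cell k false).filter fun x => κ (bxor x a) = true) = (Cell k false).filter fun x => ¬ (κ x = true) := by
        refine filter_congr fun x hx => ?_
        rw [hκa, hq_on x hx, hpk]; cases κ x <;> simp
      rw [e]
      have := card_filter_add_card_filter_not (s := Cell k false) (fun x => κ x = true)
      rw [hCellcard k hk] at this
      show _ = 128 - #((Cell k false).filter fun x => κ x = true)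
      omega
    · have hpk' : (πq k) = false := by revert hpk; cases (πq k) <;> simp
      refine congrArg card (filter_congr fun x hx => ?_)
      rw [hκa, hq_on x hx, hpk', Bool.xor_false]
  -- masks and the 9-flats `U`
  set wv : ℕ → Fin (6 + 6) → Bool := fun m l =>
    (Nat.testBit m 0 && c₀ l) ^^ (Nat.testBit m 1 && c₁ l) ^^ (Nat.testBit m 2 && c₂ l) ^^ (Nat.testBit m 3 && c₃ l) with hwv
  set Bm : ℕ → Bool := fun m => (Nat.testBit m 0 && b₀) ^^ (Nat.testBit m 1 && b₁) ^^ (Nat.testBit m 2 && b₂) ^^ (Nat.testBit m 3 && b₃) with hBm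
  have h𝕚 : ∀ m x, (𝕚 m (lab x)) = (Bm m ^^ decide (Odd #(univ.filter fun j => x j && wv m j))) := by
    intro m x
    obtain ⟨-, e0, e1, e2, e3⟩ := hlabbits x
    rw [e0, e1, e2, e3, hc₀ x, hc₁ x, hc₂ x, hc₃ x]
    exact tow_mask_parity x c₀ c₁ c₂ c₃ b₀ b₁ b₂ b₃ _ _ _ _
  set U : ℕ → ℕ → Bool → Bool → Bool → Finset (Fin (6 + 6) → Bool) := fun m₁ m₂ c₁ c₂ c =>
    univ.filter fun x => (𝕚 m₁ (lab x)) = c₁ ∧ (𝕚 m₂ (lab x)) = c₂ ∧ decide (Odd #(univ.filter fun j => x j && y₅ j)) = c with hU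
  have hUpar : ∀ m₁ m₂ c₁ c₂ c, U m₁ m₂ c₁ c₂ c = univ.filter fun x : Fin (6 + 6) → Bool =>
      ∀ i : Fin 3, decide (Odd #(univ.filter fun j => x j && (![wv m₁, wv m₂, y₅] : Fin 3 → Fin (6 + 6) → Bool) i j)) =
        (![xor c₁ (Bm m₁), xor c₂ (Bm m₂), c] : Fin 3 → Bool) i := by
    intro m₁ m₂ c₁ c₂ c
    refine filter_congr fun x _ => ?_
    rw [tow_forall_fin3P]
    have ew2 : (![wv m₁, wv m₂, y₅] : Fin 3 → Fin (6 + 6) → Bool) 2 = y₅ := rfl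
    have ev2 : (![xor c₁ (Bm m₁), xor c₂ (Bm m₂), c] : Fin 3 → Bool) 2 = c := rfl
    simp only [Matrix.cons_val_zero, Matrix.cons_val_one, ew2, ev2]
    rw [h𝕚 m₁ x, h𝕚 m₂ x]
    constructor
    · rintro ⟨g1, g2, g3⟩
      refine ⟨?_, ?_, g3⟩
      · revert g1; cases Bm m₁ <;> cases c₁ <;> cases decide (Odd #(univ.filter fun j => x j && wv m₁ j)) <;> simp
      · revert g2; cases Bm m₂ <;> cases c₂ <;> cases decide (Odd #(univ.filter fun j => x j && wv m₂ j)) <;> simp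
    · rintro ⟨g1, g2, g3⟩
      refine ⟨?_, ?_, g3⟩
      · revert g1; cases Bm m₁ <;> cases c₁ <;> cases decide (Odd #(univ.filter fun j => x j && wv m₁ j)) <;> simp
      · revert g2; cases Bm m₂ <;> cases c₂ <;> cases decide (Odd #(univ.filter fun j => x j && wv m₂ j)) <;> simp
  have hUfiber : ∀ m₁ m₂ c₁ c₂ c k, ((U m₁ m₂ c₁ c₂ c).filter fun x => lab x = k) =
      if ((𝕚 m₁ k) = c₁ ∧ (𝕚 m₂ k) = c₂) then Cell k c else ∅ := by
    intro m₁ m₂ c₁ c₂ c k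
    ext x
    simp only [hU, hCell, mem_filter, mem_univ, true_and]
    split_ifs with hc
    · simp only [mem_filter, mem_univ, true_and]
      constructor
      · rintro ⟨⟨-, -, h3⟩, h4⟩; exact ⟨h4, h3⟩
      · rintro ⟨h4, h3⟩; rw [h4]; exact ⟨⟨hc.1, hc.2, h3⟩, rfl⟩
    · simp only [Finset.notMem_empty, iff_false, not_and]
      rintro ⟨h1, h2, -⟩ h4
      rw [h4] at h1 h2
      exact hc ⟨h1, h2⟩
  have hUcard : ∀ m₁ < 16, ∀ m₂ < 16, 0 < m₁ → m₁ < m₂ → ∀ c₁ c₂ c, #(U m₁ m₂ c₁ c₂ c) = 512 := by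
    intro m₁ hm₁ m₂ hm₂ h0 hlt c₁ c₂ c
    rw [card_eq_sum_card_fiberwise (t := range 16) (f := lab) (fun x _ => mem_range.2 (hlabbits x).1)]
    have e : ∀ k ∈ range 16, #((U m₁ m₂ c₁ c₂ c).filter fun x => lab x = k) = if ((𝕚 m₁ k) = c₁ ∧ (𝕚 m₂ k) = c₂) then 128 else 0 := by
      intro k hk
      rw [hUfiber]
      split_ifs with h
      · exact hCellcard k (mem_range.1 hk) c
      · rfl
    rw [sum_congr rfl e, ← sum_filter, sum_const, smul_eq_mul, tow_mask_count4 m₁ hm₁ m₂ hm₂ h0 hlt c₁ c₂]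
  have hbinj : ∀ p : Fin (6 + 6) → Bool, Function.Injective (bxor p) := fun p x y hxy => by
    have := congrArg (bxor p) hxy
    rwa [bxor_bxor_cancel_left, bxor_bxor_cancel_left] at this
  have hflat : ∀ m₁ < 16, ∀ m₂ < 16, 0 < m₁ → m₁ < m₂ → ∀ c₁ c₂ c, ∃ p : Fin (6 + 6) → Bool, U m₁ m₂ c₁ c₂ c =
      (univ.filter fun t : Fin (6 + 6) → Bool => ∀ i : Fin 3, twist ((![wv m₁, wv m₂, y₅] : Fin 3 → Fin (6 + 6) → Bool) i) t = 1).image (bxor p) := by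
    intro m₁ hm₁ m₂ hm₂ h0 hlt c₁ c₂ c
    have hne : (U m₁ m₂ c₁ c₂ c).Nonempty := card_pos.1 (by rw [hUcard m₁ hm₁ m₂ hm₂ h0 hlt]; norm_num)
    obtain ⟨p, hp⟩ := hne
    rw [hUpar] at hp ⊢
    exact ⟨p, tow_paritySet_eq_image _ _ p (mem_filter.1 hp).2⟩
  have hT : ∀ m₁ < 16, ∀ m₂ < 16, 0 < m₁ → m₁ < m₂ →
      #(univ.filter fun t : Fin (6 + 6) → Bool => ∀ i : Fin 3, twist ((![wv m₁, wv m₂, y₅] : Fin 3 → Fin (6 + 6) → Bool) i) t = 1) = 512 := by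
    intro m₁ hm₁ m₂ hm₂ h0 hlt
    obtain ⟨p, hp⟩ := hflat m₁ hm₁ m₂ hm₂ h0 hlt false false false
    have := hUcard m₁ hm₁ m₂ hm₂ h0 hlt false false false
    rwa [hp, card_image_of_injective _ (hbinj p)] at this
  -- counting the flats through the cells
  have hCS : ∀ m₁ m₂ c₁ c₂, #((U m₁ m₂ c₁ c₂ false).filter fun x => κ x = true) = CS s m₁ m₂ c₁ c₂ := by
    intro m₁ m₂ c₁ c₂
    rw [card_eq_sum_card_fiberwise (t := range 16) (f := lab) (fun x _ => mem_range.2 (hlabbits x).1)]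
    refine sum_congr rfl fun k hk => ?_
    have e : ((U m₁ m₂ c₁ c₂ false).filter fun x => κ x = true).filter (fun x => lab x = k) =
        ((U m₁ m₂ c₁ c₂ false).filter fun x => lab x = k).filter fun x => κ x = true := by
      ext x; simp only [mem_filter, mem_univ, true_and, hU]
      constructor <;> rintro ⟨⟨h1, h2⟩, h3⟩ <;> exact ⟨⟨h1, h3⟩, h2⟩
    rw [e, hUfiber]
    by_cases h : ((𝕚 m₁ k) = c₁ ∧ (𝕚 m₂ k) = c₂)
    · rw [if_pos h, if_pos h]
    · rw [if_neg h, if_neg h, Finset.filter_empty, Finset.card_empty]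
  have hCT : ∀ m₁ m₂ c₁ c₂, #((U m₁ m₂ c₁ c₂ true).filter fun x => κ x = true) = CT s m₁ m₂ c₁ c₂ := by
    intro m₁ m₂ c₁ c₂
    rw [card_eq_sum_card_fiberwise (t := range 16) (f := lab) (fun x _ => mem_range.2 (hlabbits x).1)]
    refine sum_congr rfl fun k hk => ?_
    have e : ((U m₁ m₂ c₁ c₂ true).filter fun x => κ x = true).filter (fun x => lab x = k) =
        ((U m₁ m₂ c₁ c₂ true).filter fun x => lab x = k).filter fun x => κ x = true := by
      ext x; simp only [mem_filter, mem_univ, true_and, hU]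
      constructor <;> rintro ⟨⟨h1, h2⟩, h3⟩ <;> exact ⟨⟨h1, h3⟩, h2⟩
    rw [e, hUfiber]
    by_cases h : ((𝕚 m₁ k) = c₁ ∧ (𝕚 m₂ k) = c₂)
    · rw [if_pos h, if_pos h, hside1 k (mem_range.1 hk)]
    · rw [if_neg h, if_neg h, Finset.filter_empty, Finset.card_empty]
  -- the TYPE PRINCIPLE and Kasami–Tokura on the flats
  have hTP : ∀ m₁ < 16, ∀ m₂ < 16, 0 < m₁ → m₁ < m₂ → ∀ c₁ c₂ c c₁' c₂' c',
      ((#((U m₁ m₂ c₁ c₂ c).filter fun x => κ x = true) : ℤ)) % 8 = ((#((U m₁ m₂ c₁' c₂' c').filter fun x => κ x = true) : ℤ)) % 8 := by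
    intro m₁ hm₁ m₂ hm₂ h0 hlt c₁ c₂ c c₁' c₂' c'
    obtain ⟨p, hp⟩ := hflat m₁ hm₁ m₂ hm₂ h0 hlt c₁ c₂ c
    obtain ⟨p', hp'⟩ := hflat m₁ hm₁ m₂ hm₂ h0 hlt c₁' c₂' c'
    rw [hp, hp', tow_flat_type κ hκ u hu hodd _ (hT m₁ hm₁ m₂ hm₂ h0 hlt) p, tow_flat_type κ hκ u hu hodd _ (hT m₁ hm₁ m₂ hm₂ h0 hlt) p']
  have hKT : ∀ m₁ < 16, ∀ m₂ < 16, 0 < m₁ → m₁ < m₂ → ∀ c₁ c₂ c,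
      #((U m₁ m₂ c₁ c₂ c).filter fun x => κ x = true) % 8 = 4 → 132 ≤ #((U m₁ m₂ c₁ c₂ c).filter fun x => κ x = true) := by
    intro m₁ hm₁ m₂ hm₂ h0 hlt c₁ c₂ c h4
    obtain ⟨p, hp⟩ := hflat m₁ hm₁ m₂ hm₂ h0 hlt c₁ c₂ c
    rw [hp] at h4 ⊢
    exact tow_flat9_kt κ hκ _ (hT m₁ hm₁ m₂ hm₂ h0 hlt) p h4
  have hR : ∀ m₁ m₂ : ℕ, 0 < m₁ → m₁ < m₂ → m₂ < 16 → ∀ c₁ c₂ : Bool, CS s m₁ m₂ c₁ c₂ % 8 = CS s m₁ m₂ false false % 8 := by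
    intro m₁ m₂ h0 hlt hm₂ c₁ c₂
    have e := hTP m₁ (by omega) m₂ hm₂ h0 hlt c₁ c₂ false false false false
    rw [hCS, hCS] at e
    omega
  have hK : ∀ m₁ m₂ : ℕ, 0 < m₁ → m₁ < m₂ → m₂ < 16 → ∀ c₁ c₂ : Bool, CS s m₁ m₂ c₁ c₂ % 8 = 4 → 132 ≤ CS s m₁ m₂ c₁ c₂ := by
    intro m₁ m₂ h0 hlt hm₂ c₁ c₂ h4
    have e := hKT m₁ (by omega) m₂ hm₂ h0 hlt c₁ c₂ false
    rw [hCS] at e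
    exact e h4
  have hK' : ∀ m₁ m₂ : ℕ, 0 < m₁ → m₁ < m₂ → m₂ < 16 → ∀ c₁ c₂ : Bool, CS s m₁ m₂ c₁ c₂ % 8 = 4 → 132 ≤ CT s m₁ m₂ c₁ c₂ := by
    intro m₁ m₂ h0 hlt hm₂ c₁ c₂ h4
    have e := hTP m₁ (by omega) m₂ hm₂ h0 hlt c₁ c₂ true c₁ c₂ false
    have e' := hKT m₁ (by omega) m₂ hm₂ h0 hlt c₁ c₂ true
    rw [hCT, hCS] at e
    rw [hCT] at e'
    apply e'
    omega
  -- cells are 7-flats: `4 ∣ s k` by Ax, and `s k ≤ 128`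
  have hB : ∀ k, k < 16 → s k ≤ 128 := fun k hk => (card_filter_le _ _).trans (hCellcard k hk false).le
  have hD : ∀ k, k < 16 → 4 ∣ s k := by
    intro k hk
    have hne : (Cell k false).Nonempty := card_pos.1 (by rw [hCellcard k hk]; norm_num)
    obtain ⟨p, hp⟩ := hne
    rw [hCellpar k hk] at hp
    have eC := tow_paritySet_eq_image zz _ p (mem_filter.1 hp).2
    rw [← hCellpar k hk] at eC
    have hT5 : #(univ.filter fun t : Fin (6 + 6) → Bool => ∀ i, twist (zz i) t = 1) = 128 := by
      have := hCellcard k hk false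
      rwa [eC, card_image_of_injective _ (hbinj p)] at this
    have hs : s k = #((univ.filter fun t : Fin (6 + 6) → Bool => ∀ i, twist (zz i) t = 1).filter fun y => κ (bxor p y) = true) := by
      show #((Cell k false).filter fun x => κ x = true) = _
      rw [eC, tow_card_filter_translate (univ.filter fun t : Fin (6 + 6) → Bool => ∀ i, twist (zz i) t = 1)
        ((univ.filter fun t : Fin (6 + 6) → Bool => ∀ i, twist (zz i) t = 1).image (bxor p)) p κ ?_]
      · exact congrArg card (filter_congr fun x _ => by rw [bxor_comm x p])
      · intro x
        constructor
        · intro hx; rw [bxor_comm x p]; exact mem_image_of_mem _ hx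
        · intro hx
          obtain ⟨t, ht, e⟩ := mem_image.1 hx
          have : t = x := by
            have := congrArg (bxor p) e
            rwa [bxor_bxor_cancel_left, bxor_comm x p, bxor_bxor_cancel_left] at this
          rw [← this]; exact ht
    obtain ⟨z, hz⟩ := fs_ax_annihilator (n := 6 + 6) (k := 5) (d := 3) (by norm_num) (fun y => κ (bxor p y)) (te_isDegLeFun_shift hκ p) zz
    rw [tow_sum_signOf_eq, hT5, ← hs] at hz
    have e3 : ((6 + 6 - 5 + 3 - 1) / 3 : ℕ) = 3 := by norm_num
    rw [e3] at hz
    have hz' : ((128 : ℤ) - 2 * (s k : ℤ) : ℝ) = ((8 * z : ℤ) : ℝ) := by push_cast at hz ⊢; rw [hz]; norm_num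
    have hz'' : (128 : ℤ) - 2 * (s k : ℤ) = 8 * z := by exact_mod_cast hz'
    omega
  -- the weight through the cells
  have hwt : #(univ.filter fun x : Fin (6 + 6) → Bool => κ x = true) =
      ∑ k ∈ range 16, (s k + (if (πq k) = true then 128 - s k else s k)) := by
    rw [card_eq_sum_card_fiberwise (t := range 16) (f := lab) (fun x _ => mem_range.2 (hlabbits x).1)]
    refine sum_congr rfl fun k hk => ?_
    have hk' := mem_range.1 hk
    rw [← hside1 k hk', ← card_filter_add_card_filter_not (s := (univ.filter fun x : Fin (6 + 6) → Bool => κ x = true).filter fun x => lab x = k)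
      (fun x => decide (Odd #(univ.filter fun j => x j && y₅ j)) = false)]
    congr 1
    · congr 1; ext x; simp only [hCell, mem_filter, mem_univ, true_and]
      constructor
      · rintro ⟨⟨h1, h2⟩, h3⟩; exact ⟨⟨h2, h3⟩, h1⟩
      · rintro ⟨⟨h2, h3⟩, h1⟩; exact ⟨⟨h1, h2⟩, h3⟩
    · congr 1; ext x; simp only [hCell, mem_filter, mem_univ, true_and, Bool.not_eq_false]
      constructor
      · rintro ⟨⟨h1, h2⟩, h3⟩; exact ⟨⟨h2, h3⟩, h1⟩
      · rintro ⟨⟨h2, h3⟩, h1⟩; exact ⟨⟨h1, h2⟩, h3⟩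
  have hO : ZS s % 8 = 4 := by
    have b3 := hB 3 (by norm_num); have b7 := hB 7 (by norm_num); have b11 := hB 11 (by norm_num)
    have b12 := hB 12 (by norm_num); have b13 := hB 13 (by norm_num); have b14 := hB 14 (by norm_num)
    rw [hwt] at hw
    revert hw
    simp (config := { decide := true }) only [Finset.sum_range_succ, Finset.sum_range_zero, ite_true, ite_false, zero_add, add_zero]
    clear * - b3 b7 b11 b12 b13 b14
    omega
  have h268 := tow_r4_arith s hD hB hR hK hK' hO
  have b3 := hB 3 (by norm_num); have b7 := hB 7 (by norm_num); have b11 := hB 11 (by norm_num)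
  have b12 := hB 12 (by norm_num); have b13 := hB 13 (by norm_num); have b14 := hB 14 (by norm_num)
  rw [hwt]
  revert h268
  simp (config := { decide := true }) only [Finset.sum_range_succ, Finset.sum_range_zero, ite_true, ite_false, zero_add, add_zero]
  clear * - b3 b7 b11 b12 b13 b14
  omega

end Summit.QuantumAdvantage.QuantumAdvantage.Theorems.CubicForrelation.NearExactIsExact

end
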